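import Mathlib
import Summits.MatrixMultiplication.MatrixMultiplication.Theorems.GradedDesignFamily.Negative.SubfieldCellOvergroupsAux
import Summits.MatrixMultiplication.MatrixMultiplication.Theorems.GradedDesignFamily.Negative.SubfieldCellRootGroups
import Summits.MatrixMultiplication.MatrixMultiplication.Theorems.GradedDesignFamily.Negative.SubfieldCellSubfield
import Summits.MatrixMultiplication.MatrixMultiplication.Theorems.GradedDesignFamily.Negative.SubfieldCellSubfieldTwo
import Summits.MatrixMultiplication.MatrixMultiplication.Theorems.GradedDesignFamily.Negative.SubfieldCellCentralizer
import Literature.NumberTheory.GaloisRepresentations.SL2WreathResidualImage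

/-!
# Subfield cell — overgroups of `SL₂(k)` inside `SL₂(K)` for `[K : k] = 2` (route (D′), step (O))

HONEST FRAMING. This is a step in the NEGATIVE decision of the subfield-cell stub `S3` of the
crux `LevelGradedCohnUmans.GradedDesignFamily` (stmt-MatrixMultiplication-7610): its value is a
THEOREM about finite groups, used to remove the hypothesis (Dickson) from
`not_subfieldCell_of_BGT_Dickson` — NOT summit progress.

## Main result

`subfieldCell_overgroup`: let `ι : k →+* K` be a ring map of finite fields with
`|K| = |k| ^ 2` and `|k| ≥ 5`, and let `L ≤ ker det ⊆ GL₂(K)` be a subgroup containing the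
standard copy `toGL (map ι (SL₂ k))`.  Then either `L = ker det` (i.e. `ker det ≤ L`) or
`|L| ≤ 4 |k| ^ 3`.

## Proof sketch (elementary; no use of Dickson's classification)

The root set `A = {x : K | u(x) ∈ L}` is an additive group containing `ι k` and stable under
multiplication by `ι k` (squares act through diagonal conjugation, and squares additively generate
a finite field).  If `A ⊄ ι k` then `|A| ≥ |k|² = |K|`, so `A = K`, all root groups lie in `L`
and `L ⊇ ker det` (`ker_det_le_of_rootGroups`).  Otherwise `A ⊆ ι k`; then the stabiliser in `L`
of the point `∞ = [1 : 0]` of `ℙ¹(K)` has at most `2|k|²` elements (fibres of the diagonal entry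
have `≤ |A|` elements, and the diagonal entries `θ` satisfy `θ² A ⊆ A`, whence at most `2|A|` of
them).  If the `L`-orbit of `∞` consists of `k`-rational points, orbit–stabiliser gives
`|L| ≤ (|k|+1) · 2|k|²`.  If some `g ∈ L` moves `∞` to a non-rational point `m₀`, then the
stabiliser of `m₀` in `SL₂(k)` is conjugated by `g` into the stabiliser of `∞` in `L`; the
eigenvalue `θ` of such an element on the line `m₀` has `θ² ∈ A ⊆ ι k`, which by a
Cayley–Hamilton computation forces `θ ∈ {±1} ∪ {θ² = -1}` and the element to be determined by
`θ`; so that stabiliser has at most `4` elements, contradicting orbit–stabiliser in `SL₂(k)`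
(`|k|(|k|²-1) ≤ 4(|k|²+1)` fails for `|k| ≥ 5`).

Sorry-free. [folklore]
-/

set_option linter.dupNamespace false

open Matrix
open scoped Pointwise LinearAlgebra.Projectivization

namespace Summit.MatrixMultiplication.MatrixMultiplication.Theorems.GradedDesignFamily.Negative

section Overgroups

variable {k K : Type} [Field k] [Fintype k] [DecidableEq k] [Field K] [Fintype K] [DecidableEq K]

/-- **Overgroups of `SL₂(k)` in `SL₂(K)`, `[K : k] = 2`.**  A subgroup `L ≤ ker det ⊆ GL₂(K)`
containing the standard copy of `SL₂(k)` is all of `ker det` or has at most `4|k|³` elements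
(`|k| ≥ 5`). [folklore] -/
theorem subfieldCell_overgroup (ι : k →+* K) (hK : Fintype.card K = Fintype.card k ^ 2)
    (hq : 5 ≤ Fintype.card k) (L : Subgroup (Matrix.GeneralLinearGroup (Fin 2) K))
    (hL : L ≤ (Matrix.GeneralLinearGroup.det : Matrix.GeneralLinearGroup (Fin 2) K →* Kˣ).ker)
    (hS : ∀ a : Matrix.SpecialLinearGroup (Fin 2) k,
      Matrix.SpecialLinearGroup.toGL (Matrix.SpecialLinearGroup.map ι a) ∈ L) :
    (Matrix.GeneralLinearGroup.det : Matrix.GeneralLinearGroup (Fin 2) K →* Kˣ).ker ≤ L ∨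
      Nat.card L ≤ 4 * Fintype.card k ^ 3 := by
  classical
  set q := Fintype.card k with hqdef
  have hdetL : ∀ g ∈ L, ((g : Matrix.GeneralLinearGroup (Fin 2) K) :
      Matrix (Fin 2) (Fin 2) K).det = 1 := by
    intro g hg
    rw [← Matrix.GeneralLinearGroup.val_det_apply, MonoidHom.mem_ker.1 (hL hg), Units.val_one]
  /- ### the root set -/
  set A : Finset K := Finset.univ.filter (fun x : K => Matrix.SpecialLinearGroup.toGL
    (⟨!![(1 : K), x; 0, 1], sl2md_det_upper x⟩ : Matrix.SpecialLinearGroup (Fin 2) K) ∈ L)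
    with hAdef
  have hAmem : ∀ x, x ∈ A ↔ Matrix.SpecialLinearGroup.toGL
      (⟨!![(1 : K), x; 0, 1], sl2md_det_upper x⟩ : Matrix.SpecialLinearGroup (Fin 2) K) ∈ L := by
    intro x
    rw [hAdef, Finset.mem_filter]
    simp only [Finset.mem_univ, true_and]
  have hA_add : ∀ x ∈ A, ∀ y ∈ A, x + y ∈ A := by
    intro x hx y hy
    rw [hAmem] at hx hy ⊢
    rw [← sl2md_upper_mul x y, map_mul]
    exact mul_mem hx hy
  have hA_iota : ∀ b : k, ι b ∈ A := by
    intro b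
    rw [hAmem, ← subfieldCell_std_upper ι b]
    exact hS _
  have h1A : (1 : K) ∈ A := by simpa using hA_iota 1
  have hA_sq : ∀ b : k, ∀ x ∈ A, ι b ^ 2 * x ∈ A := by
    intro b x hx
    by_cases hb : b = 0
    · rw [hb, map_zero, zero_pow two_ne_zero, zero_mul, ← ι.map_zero]
      exact hA_iota 0
    have hD := hS ⟨!![((Units.mk0 b hb : kˣ) : k), 0; 0, (((Units.mk0 b hb)⁻¹ : kˣ) : k)],
      sl2md_det_diag (Units.mk0 b hb)⟩
    have h := subfieldCell_upper_conj_root _ (by simp) (hdetL _ hD) x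
    have h00 : ((Matrix.SpecialLinearGroup.toGL (Matrix.SpecialLinearGroup.map ι
        ⟨!![((Units.mk0 b hb : kˣ) : k), 0; 0, (((Units.mk0 b hb)⁻¹ : kˣ) : k)],
          sl2md_det_diag (Units.mk0 b hb)⟩) : Matrix.GeneralLinearGroup (Fin 2) K) :
            Matrix (Fin 2) (Fin 2) K) 0 0 = ι b := by
      simp
    rw [h00] at h
    rw [hAmem, ← h]
    exact mul_mem (mul_mem hD ((hAmem x).1 hx)) (inv_mem hD)
  have hA_mul : ∀ b : k, ∀ x ∈ A, ι b * x ∈ A := fun b => mul_mem_of_sq_mul_mem ι A hA_add hA_sq b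
  by_cases hAll : ∃ x₀ ∈ A, ∀ b : k, ι b ≠ x₀
  · /- ### Case `A ⊄ ι k`: all root groups lie in `L` -/
    obtain ⟨x₀, hx₀, hnr⟩ := hAll
    have hinj : Function.Injective (fun p : k × k => ι p.1 + ι p.2 * x₀) := by
      rintro ⟨c, d⟩ ⟨c', d'⟩ h
      simp only at h
      by_cases hd : d = d'
      · subst hd
        have hc : ι c = ι c' := add_right_cancel h
        rw [ι.injective hc]
      · exfalso
        apply hnr ((c - c') / (d' - d))
        have hdd : ι d' - ι d ≠ 0 := sub_ne_zero.2 fun e => hd (ι.injective e).symm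
        rw [map_div₀, map_sub, map_sub, div_eq_iff hdd]
        linear_combination h
    have hAuniv : A = Finset.univ := by
      apply Finset.eq_univ_of_card
      refine le_antisymm (Finset.card_le_univ _) ?_
      calc Fintype.card K
          = (Finset.univ.image (fun p : k × k => ι p.1 + ι p.2 * x₀)).card := by
            rw [Finset.card_image_of_injective _ hinj, Finset.card_univ, Fintype.card_prod, hK, sq]
        _ ≤ A.card := Finset.card_le_card fun y hy => by
            obtain ⟨p, -, rfl⟩ := Finset.mem_image.1 hy
            exact hA_add _ (hA_iota p.1) _ (hA_mul p.2 x₀ hx₀)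
    have hAK : ∀ x : K, x ∈ A := fun x => by rw [hAuniv]; exact Finset.mem_univ x
    left
    have hW : Matrix.SpecialLinearGroup.toGL
        (⟨!![(0 : K), 1; -1, 0], sl2md_det_weyl⟩ : Matrix.SpecialLinearGroup (Fin 2) K) ∈ L := by
      rw [← subfieldCell_std_weyl ι]
      exact hS _
    apply ker_det_le_of_rootGroups L 1
    · intro x
      rw [one_mul, inv_one, mul_one]
      exact (hAmem x).1 (hAK x)
    · intro x
      rw [one_mul, inv_one, mul_one, ← subfieldCell_lower_eq_conj x, map_mul, map_mul, map_inv]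
      exact mul_mem (mul_mem hW ((hAmem (-x)).1 (hAK (-x)))) (inv_mem hW)
  /- ### Case `A ⊆ ι k` -/
  push Not at hAll
  right
  have hAcard : A.card ≤ q := by
    calc A.card ≤ (Finset.univ.image ι).card := Finset.card_le_card fun x hx => by
            obtain ⟨b, hb⟩ := hAll x hx
            exact Finset.mem_image.2 ⟨b, Finset.mem_univ _, hb⟩
      _ ≤ q := Finset.card_image_le.trans (by rw [Finset.card_univ])
  -- the point `∞ = [1 : 0]` of the projective line
  have he : (![(1 : K), 0] : Fin 2 → K) ≠ 0 := by
    intro h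
    have := congr_fun h 0
    simp at this
  have he_mul : ∀ X : Matrix (Fin 2) (Fin 2) K, X *ᵥ ![(1 : K), 0] = ![X 0 0, X 1 0] := by
    intro X
    ext i
    fin_cases i <;> simp [Matrix.mulVec, dotProduct, Fin.sum_univ_two]
  set pinf : ℙ K (Fin 2 → K) := Projectivization.mk K ![(1 : K), 0] he with hpinf
  -- upper-triangular elements of `L` and their diagonal entries
  set Hf : Finset (Matrix.GeneralLinearGroup (Fin 2) K) := Finset.univ.filter
    (fun g : Matrix.GeneralLinearGroup (Fin 2) K => g ∈ L ∧
      (g : Matrix (Fin 2) (Fin 2) K) 1 0 = 0) with hHfdef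
  have hHfmem : ∀ g : Matrix.GeneralLinearGroup (Fin 2) K,
      g ∈ Hf ↔ g ∈ L ∧ (g : Matrix (Fin 2) (Fin 2) K) 1 0 = 0 := by
    intro g
    rw [hHfdef, Finset.mem_filter]
    simp only [Finset.mem_univ, true_and]
  set T : Finset K := Hf.image (fun g : Matrix.GeneralLinearGroup (Fin 2) K =>
    (g : Matrix (Fin 2) (Fin 2) K) 0 0) with hTdef
  have hT : ∀ θ ∈ T, ∀ x ∈ A, θ ^ 2 * x ∈ A := by
    intro θ hθ x hx
    obtain ⟨g, hg, rfl⟩ := Finset.mem_image.1 hθ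
    obtain ⟨hgL, hg10⟩ := (hHfmem g).1 hg
    rw [hAmem, ← subfieldCell_upper_conj_root g hg10 (hdetL g hgL) x]
    exact mul_mem (mul_mem hgL ((hAmem x).1 hx)) (inv_mem hgL)
  have hTcard : T.card ≤ 2 * A.card := card_le_two_mul_of_sq_mul_mem A T h1A one_ne_zero hT
  -- fibres of the diagonal entry on `Hf` have at most `|A| ≤ q` elements
  have hfib : ∀ θ ∈ T, (Hf.filter fun g : Matrix.GeneralLinearGroup (Fin 2) K =>
      (g : Matrix (Fin 2) (Fin 2) K) 0 0 = θ).card ≤ q := by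
    intro θ hθ
    obtain ⟨g₀, hg₀, rfl⟩ := Finset.mem_image.1 hθ
    obtain ⟨hg₀L, hg₀10⟩ := (hHfmem g₀).1 hg₀
    obtain ⟨hi10, hi00⟩ := subfieldCell_inv_entries g₀ hg₀10
    have hsub : (Hf.filter fun g : Matrix.GeneralLinearGroup (Fin 2) K =>
        (g : Matrix (Fin 2) (Fin 2) K) 0 0 = (g₀ : Matrix (Fin 2) (Fin 2) K) 0 0) ⊆
        A.image (fun y : K => Matrix.SpecialLinearGroup.toGL
          (⟨!![(1 : K), y; 0, 1], sl2md_det_upper y⟩ : Matrix.SpecialLinearGroup (Fin 2) K) * g₀) := by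
      intro g hg
      rw [Finset.mem_filter] at hg
      obtain ⟨hg, hg00⟩ := hg
      obtain ⟨hgL, hg10⟩ := (hHfmem g).1 hg
      have hXL : g * g₀⁻¹ ∈ L := mul_mem hgL (inv_mem hg₀L)
      have hX : ((g * g₀⁻¹ : Matrix.GeneralLinearGroup (Fin 2) K) : Matrix (Fin 2) (Fin 2) K) =
          (g : Matrix (Fin 2) (Fin 2) K) * ((g₀⁻¹ : Matrix.GeneralLinearGroup (Fin 2) K) :
            Matrix (Fin 2) (Fin 2) K) := Units.val_mul _ _
      have hX10 : ((g * g₀⁻¹ : Matrix.GeneralLinearGroup (Fin 2) K) :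
          Matrix (Fin 2) (Fin 2) K) 1 0 = 0 := by
        rw [hX, Matrix.mul_apply, Fin.sum_univ_two, hg10, hi10]; ring
      have hX00 : ((g * g₀⁻¹ : Matrix.GeneralLinearGroup (Fin 2) K) :
          Matrix (Fin 2) (Fin 2) K) 0 0 = 1 := by
        rw [hX, Matrix.mul_apply, Fin.sum_univ_two, hi10, mul_zero, add_zero, hg00, mul_comm]
        exact hi00
      have hGL := subfieldCell_GL_eq_upper (g * g₀⁻¹) hX00 hX10 (hdetL _ hXL)
      refine Finset.mem_image.2 ⟨_, (hAmem _).2 (hGL ▸ hXL), ?_⟩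
      rw [← hGL, inv_mul_cancel_right]
    calc _ ≤ (A.image _).card := Finset.card_le_card hsub
      _ ≤ A.card := Finset.card_image_le
      _ ≤ q := hAcard
  -- the stabiliser of `∞` in `L` has at most `2 q²` elements
  have hstab : Nat.card (MulAction.stabilizer L pinf) ≤ 2 * q ^ 2 := by
    have h1 : Nat.card (MulAction.stabilizer L pinf) =
        (Finset.univ.filter (fun l : L => l • pinf = pinf)).card :=
      Nat.subtype_card _ (fun l => by
        rw [Finset.mem_filter, MulAction.mem_stabilizer_iff]
        simp only [Finset.mem_univ, true_and])
    have h2 : (Finset.univ.filter (fun l : L => l • pinf = pinf)).card ≤ Hf.card := by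
      apply Finset.card_le_card_of_injOn (fun l : L => (l : Matrix.GeneralLinearGroup (Fin 2) K))
      · intro l hl
        simp only [Finset.coe_filter, Finset.mem_univ, true_and, Set.mem_setOf_eq] at hl
        rw [Finset.mem_coe, hHfmem]
        refine ⟨l.2, ?_⟩
        rw [Subgroup.smul_def, hpinf, Projectivization.smul_mk, Projectivization.mk_eq_mk_iff'] at hl
        obtain ⟨a, ha⟩ := hl
        have := congr_fun ha 1
        rw [Units.smul_def, Matrix.smul_eq_mulVec, he_mul] at this
        simpa using this.symm
      · intro l₁ _ l₂ _ h
        exact Subtype.ext h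
    calc Nat.card (MulAction.stabilizer L pinf) = _ := h1
      _ ≤ Hf.card := h2
      _ ≤ q * T.card := Finset.card_le_mul_card_image Hf q hfib
      _ ≤ q * (2 * A.card) := Nat.mul_le_mul_left q hTcard
      _ ≤ q * (2 * q) := Nat.mul_le_mul_left q (Nat.mul_le_mul_left 2 hAcard)
      _ = 2 * q ^ 2 := by ring
  -- orbit–stabiliser in `L`
  have hOS : (MulAction.orbit L pinf).ncard * Nat.card (MulAction.stabilizer L pinf) =
      Nat.card L := by
    rw [← MulAction.index_stabilizer, Subgroup.index_mul_card]
  -- the rational points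
  have hx1 : ∀ x : k, (![ι x, 1] : Fin 2 → K) ≠ 0 := fun x h => by
    have := congr_fun h 1
    simp at this
  set RatF : Finset (ℙ K (Fin 2 → K)) :=
    insert pinf (Finset.univ.image fun x : k => Projectivization.mk K ![ι x, 1] (hx1 x)) with hRatF
  have hRatF_card : RatF.card ≤ q + 1 := by
    calc RatF.card ≤ (Finset.univ.image fun x : k =>
          Projectivization.mk K ![ι x, 1] (hx1 x)).card + 1 := Finset.card_insert_le _ _
      _ ≤ q + 1 := by
          gcongr
          exact Finset.card_image_le.trans (by rw [Finset.card_univ])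
  by_cases hrat : MulAction.orbit L pinf ⊆ (RatF : Set (ℙ K (Fin 2 → K)))
  · /- the orbit of `∞` is rational: `|L| ≤ (q + 1) · 2q²` -/
    have hncard : (MulAction.orbit L pinf).ncard ≤ q + 1 :=
      (Set.ncard_le_ncard hrat (Finset.finite_toSet _)).trans
        (by rw [Set.ncard_coe_finset]; exact hRatF_card)
    have hq1 : 1 ≤ q := le_trans (by norm_num) hq
    calc Nat.card L = _ := hOS.symm
      _ ≤ (q + 1) * (2 * q ^ 2) := Nat.mul_le_mul hncard hstab
      _ ≤ 4 * q ^ 3 := by nlinarith [hq1]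
  /- some `g ∈ L` moves `∞` to a non-rational point: contradiction -/
  exfalso
  obtain ⟨m, hm, hmr⟩ := Set.not_subset.1 hrat
  obtain ⟨g, rfl⟩ := MulAction.mem_orbit_iff.1 hm
  obtain ⟨v, hvdef⟩ : ∃ v : Fin 2 → K,
      ((g : Matrix.GeneralLinearGroup (Fin 2) K) : Matrix (Fin 2) (Fin 2) K) *ᵥ ![(1 : K), 0] = v :=
    ⟨_, rfl⟩
  have hginv : (((g : Matrix.GeneralLinearGroup (Fin 2) K)⁻¹ : Matrix.GeneralLinearGroup (Fin 2) K) :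
      Matrix (Fin 2) (Fin 2) K) *ᵥ v = ![(1 : K), 0] := by
    rw [← hvdef, Matrix.mulVec_mulVec, Units.inv_mul, Matrix.one_mulVec]
  have hv : v ≠ 0 := by
    intro h0
    rw [h0, Matrix.mulVec_zero] at hginv
    exact he hginv.symm
  have hgv : (g • pinf : ℙ K (Fin 2 → K)) = Projectivization.mk K v hv := by
    rw [Subgroup.smul_def, hpinf, Projectivization.smul_mk, Projectivization.mk_eq_mk_iff']
    exact ⟨1, by rw [one_smul, Units.smul_def, Matrix.smul_eq_mulVec, hvdef]⟩
  have hnr : ¬ ∃ (c : K) (b : Fin 2 → k), b ≠ 0 ∧ v = c • (fun i => ι (b i)) := by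
    rintro ⟨c, b, -, hvb⟩
    apply hmr
    rw [Finset.mem_coe, hgv, hRatF, Finset.mem_insert, Finset.mem_image]
    subst hvb
    rcases subfieldCell_mk_rational ι c b hv with h | ⟨x, hx⟩
    · left
      rw [h]
    · right
      exact ⟨x, Finset.mem_univ _, hx.symm⟩
  -- `SL₂(k)` acts on the projective line through the standard embedding
  letI : MulAction (Matrix.SpecialLinearGroup (Fin 2) k) (ℙ K (Fin 2 → K)) :=
    MulAction.compHom _ (Matrix.SpecialLinearGroup.toGL.comp (Matrix.SpecialLinearGroup.map ι))
  set m₀ : ℙ K (Fin 2 → K) := Projectivization.mk K v hv with hm₀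
  have hsmul : ∀ a : Matrix.SpecialLinearGroup (Fin 2) k, a • m₀ =
      Matrix.SpecialLinearGroup.toGL (Matrix.SpecialLinearGroup.map ι a) • m₀ := fun a => rfl
  have hOS' : (MulAction.orbit (Matrix.SpecialLinearGroup (Fin 2) k) m₀).ncard *
      Nat.card (MulAction.stabilizer (Matrix.SpecialLinearGroup (Fin 2) k) m₀) =
        Nat.card (Matrix.SpecialLinearGroup (Fin 2) k) := by
    rw [← MulAction.index_stabilizer, Subgroup.index_mul_card]
  have horb : (MulAction.orbit (Matrix.SpecialLinearGroup (Fin 2) k) m₀).ncard ≤ q ^ 2 + 1 := by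
    refine (Set.ncard_le_card _).trans (le_of_eq ?_)
    rw [Projectivization.card_of_finrank_two K (Fin 2 → K) (Module.finrank_fin_fun K),
      Nat.card_eq_fintype_card, hK]
  have hSL : Nat.card (Matrix.SpecialLinearGroup (Fin 2) k) = q * (q ^ 2 - 1) :=
    Literature.NumberTheory.GaloisRepresentations.SL2Wreath.natCard_specialLinearGroup_fin_two
  -- the stabiliser of `m₀` in `SL₂(k)` has at most four elements
  have hstab' : Nat.card (MulAction.stabilizer (Matrix.SpecialLinearGroup (Fin 2) k) m₀) ≤ 4 := by
    set C : Finset (Matrix.SpecialLinearGroup (Fin 2) k) :=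
      Finset.univ.filter (fun a : Matrix.SpecialLinearGroup (Fin 2) k => a • m₀ = m₀) with hCdef
    have hC : Nat.card (MulAction.stabilizer (Matrix.SpecialLinearGroup (Fin 2) k) m₀) = C.card :=
      Nat.subtype_card _ (fun a => by
        rw [hCdef, Finset.mem_filter, MulAction.mem_stabilizer_iff]
        simp only [Finset.mem_univ, true_and])
    rw [hC]
    -- eigenvalues of stabiliser elements
    have heig : ∀ a ∈ C, ∃ θ : K,
        ((a : Matrix (Fin 2) (Fin 2) k).map ι) *ᵥ v = θ • v ∧ (θ = 1 ∨ θ = -1 ∨ θ ^ 2 + 1 = 0) := by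
      intro a ha
      rw [hCdef, Finset.mem_filter] at ha
      obtain ⟨-, ha⟩ := ha
      rw [hsmul, hm₀, Projectivization.smul_mk, Projectivization.mk_eq_mk_iff'] at ha
      obtain ⟨θ, hθ⟩ := ha
      rw [Units.smul_def, Matrix.smul_eq_mulVec, subfieldCell_std_coe] at hθ
      refine ⟨θ, hθ.symm, subfieldCell_eigen_trichotomy ι a v hv hnr θ hθ.symm ?_⟩
      -- `θ ^ 2 ∈ A ⊆ ι k`, via the conjugate `g⁻¹ (std a) g ∈ Stab_L(∞)`
      set X : Matrix.GeneralLinearGroup (Fin 2) K :=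
        (g : Matrix.GeneralLinearGroup (Fin 2) K)⁻¹ *
          Matrix.SpecialLinearGroup.toGL (Matrix.SpecialLinearGroup.map ι a) *
            (g : Matrix.GeneralLinearGroup (Fin 2) K) with hXdef
      have hXL : X ∈ L := mul_mem (mul_mem (inv_mem g.2) (hS a)) g.2
      have hXe : (X : Matrix (Fin 2) (Fin 2) K) *ᵥ ![(1 : K), 0] = θ • ![(1 : K), 0] := by
        rw [hXdef, Units.val_mul, Units.val_mul, ← Matrix.mulVec_mulVec, ← Matrix.mulVec_mulVec,
          hvdef, subfieldCell_std_coe, ← hθ, Matrix.mulVec_smul, hginv]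
      rw [he_mul] at hXe
      have hX10 : (X : Matrix (Fin 2) (Fin 2) K) 1 0 = 0 := by
        have := congr_fun hXe 1
        simpa using this
      have hX00 : (X : Matrix (Fin 2) (Fin 2) K) 0 0 = θ := by
        have := congr_fun hXe 0
        simpa using this
      have hθT : θ ∈ T := Finset.mem_image.2 ⟨X, (hHfmem X).2 ⟨hXL, hX10⟩, hX00⟩
      have hθA : θ ^ 2 ∈ A := by simpa using hT θ hθT 1 h1A
      exact hAll _ hθA
    -- the candidate eigenvalues
    set Θ : Finset K := insert (1 : K) (insert (-1 : K)
      (Finset.univ.filter fun θ : K => θ ^ 2 + 1 = 0)) with hΘdef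
    have hΘcard : Θ.card ≤ 4 := by
      have h2 : (Finset.univ.filter fun θ : K => θ ^ 2 + 1 = 0).card ≤ 2 :=
        fin_two_card_quadratic_le_two 0 1 _ (fun a ha => by
          rw [Finset.mem_filter] at ha
          linear_combination ha.2)
      calc Θ.card ≤ (insert (-1 : K) (Finset.univ.filter fun θ : K => θ ^ 2 + 1 = 0)).card + 1 :=
            Finset.card_insert_le _ _
        _ ≤ (Finset.univ.filter fun θ : K => θ ^ 2 + 1 = 0).card + 1 + 1 := by
            gcongr
            exact Finset.card_insert_le _ _
        _ ≤ 4 := by omega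
    calc C.card ≤ (Θ.image fun θ : K => θ • v).card := by
          apply Finset.card_le_card_of_injOn (fun a : Matrix.SpecialLinearGroup (Fin 2) k =>
            ((a : Matrix (Fin 2) (Fin 2) k).map ι) *ᵥ v)
          · intro a ha
            rw [Finset.mem_coe] at ha
            obtain ⟨θ, hθ, hθ'⟩ := heig a ha
            rw [Finset.mem_coe, Finset.mem_image]
            refine ⟨θ, ?_, hθ.symm⟩
            rw [hΘdef, Finset.mem_insert, Finset.mem_insert, Finset.mem_filter]
            rcases hθ' with h | h | h
            · exact Or.inl h
            · exact Or.inr (Or.inl h)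
            · exact Or.inr (Or.inr ⟨Finset.mem_univ _, h⟩)
          · intro a _ a' _ h
            exact Matrix.SpecialLinearGroup.ext _ _ (fun i j => by
              rw [subfieldCell_eq_of_map_mulVec_eq ι _ _ v hv hnr h])
      _ ≤ Θ.card := Finset.card_image_le
      _ ≤ 4 := hΘcard
  -- orbit–stabiliser in `SL₂(k)`: `q (q² - 1) ≤ (q² + 1) · 4`, absurd for `q ≥ 5`
  have hle : q * (q ^ 2 - 1) ≤ (q ^ 2 + 1) * 4 := by
    rw [← hSL, ← hOS']
    exact Nat.mul_le_mul horb hstab'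
  obtain ⟨Q2, hQ2⟩ : ∃ Q2, q ^ 2 = Q2 := ⟨_, rfl⟩
  obtain ⟨Q3, hQ3⟩ : ∃ Q3, q * Q2 = Q3 := ⟨_, rfl⟩
  have h5 : 5 * Q2 ≤ Q3 := by rw [← hQ3]; exact Nat.mul_le_mul_right Q2 hq
  have h5' : 5 * q ≤ Q2 := by rw [← hQ2, sq]; exact Nat.mul_le_mul_right q hq
  rw [hQ2, Nat.mul_sub_one, hQ3] at hle
  omega

end Overgroups

end Summit.MatrixMultiplication.MatrixMultiplication.Theorems.GradedDesignFamily.Negative
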